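import Summits.QuantumFields.BalabanUV.Beta.MultiscaleDecayDirichlet
import Summits.QuantumFields.BalabanUV.Beta.MultiscaleDistanceGraded

/-!
# Beta / MultiscaleDecayRowSums — LEVEL-FREE WEIGHTED ROW SUMS OF THE INVERSE IN THE SCALE-ADAPTED DISTANCE, WITH A LOCAL POLYNOMIAL
# PREFACTOR, UNDER THE TWO GEOMETRY CLAUSES (GRADED SCALES + CELL-COUNT GROWTH) (MODEL; O.2 item (ii-c))

The ENTRY bound of `MultiscaleDecay.decay_levelOp` (`|A⁻¹((x,i),(x′,i′))| ≤ e^{−κd_n(x,x′)}·n(x)n(x′)/μ₀`) becomes a WEIGHTED-ROW-SUM bound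
`Σ_{(x′,i′)} |A⁻¹((x,i),(x′,i′))|·e^{κ′d_n(x,x′)} ≤ K·n(x)^{d₀+2}` — the `wrs`∕`WRS` currency of `B13PerturbativeStep` (2.16) that gen-5's RowData
chain consumed with k-DEPENDENT constants (`CovariantTowerWRS.wrs_LTorus`) — with `K` depending on `d, c, a, L, R, G₀, Λ, κ, κ′` ONLY, once
the cell family obeys the two DATA-level clauses modelling [B6] (2.1)–(2.2): GRADED scales (`MultiscaleDistanceGraded`: the scale exponent is
bondwise Lipschitz with constant `slen/R`) and cell-count GROWTH (`#{x′ : d_n(x,x′) < m} ≤ G₀·n(x)^{d₀}·Λ^m` for every `m : ℕ` — bounded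
degree of the cube-adjacency structure); rate condition `Λ·e^{−(κ − κ′ − log L/R)} < 1`.  The prefactor `n(x)^{d₀+2}` is LOCAL (the scale
at the row's site), the SHAPE of print's scale-weighted norms [B9] (3.41)
(unit `b2b-balaban-beta-d4-p2`, GEN 8, MODEL crew; claim «MULTISCALE-DECAY-MODEL» l.18614, «MINE (row-sums)» l.19504; over (L2) p230877, (w3a)
p231385, (ii-a) p231773).

HONEST FRAMING: discharging `BetaPertH` makes Bałaban's UV stability UNCONDITIONAL — NOT the continuum limit, NOT the Clay problem.
HONEST DEPENDENCY (verbatim): «continuum YM on T⁴ ⇐ BetaPertH ∧ nine spine estimates (0/9 proved); BetaPertH ⇐ (D1) ∧ (D4) ∧ CAP+tail;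
G-an2-4 gates asym, D1 and NE2/3/4.»  THIS MODULE DISCHARGES NOTHING of `BetaPertH`, asserts NOTHING printed and cites nothing as a fact
(ABSOLUTE RULE): [folklore] summation bookkeeping (shell decomposition by `⌊d_n⌋`, geometric series); the growth and graded clauses are
HYPOTHESES ON DATA (the SHAPE of (2.1)–(2.2)), not statements about Bałaban's domains; nothing of Bałaban's own operators.  NOT here: the
within-scale ℓ² → ℓ^∞ step (item (ii-b)); the scale-adapted parametrix (w4).  LOCI (shape only): [B6] = `Balaban1984PropagatorsII`
(2.1)–(2.2) p. 224, (2.46) p. 231; [B9] = `Balaban1985BackgroundPropagators` (3.41)–(3.42) p. 397; [II] = `Balaban1988RG2Cluster` (2.16) p. 15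
(the WRS currency).  No class change on row D4 (critical-path width 0; D4 DISCHARGE NO DATE); NOT BetaPertH, NOT continuum, NOT Clay, NOT
summit progress.

CONTENT (kernel, 0 sorry).  §1 **`sum_exp_neg_le_of_growth`** (growth `#{f < m} ≤ N₀Λ^m` ⟹ `Σ_y e^{−δ f(y)} ≤ N₀Λ/(1 − Λe^{−δ})`).  §2
**`wrs_le_of_entry_decay`** (entry decay with symmetric prefactors + graded comparison + growth ⟹ weighted row sums `≤ B·|Cp|·N-const·n(x)^{d₀+2}`).
§3 the torus ENDs **`wrs_inv_levelOp_le`** (full inverse) and **`wrs_dirInv_levelOp_le`** (every Dirichlet compression).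

v1.0.1 (DOCFIX, GEN 8, after t4-ne9-formalise-leaf-04-g28's LOCATED OBJECTION O-ne9leaf04g28-1 «RIGID GRADING», journal l.19783, ADOPTED —
nothing below is false, all decls byte-identical): §3's graded binder `hgr` (bondwise, ℕ-valued exponent, via `MultiscaleDistanceGraded` §2)
admits on `UT N` only CONSTANT scales when `R > 1`, so §3 is the one-scale case; the step geometry of [B6] (2.1)–(2.2) is the ADDITIVE datum
`|e(x) − e(y)| ≤ A + d_n(x,y)/R` (`MultiscaleDistanceGraded` v1.1 §4), on which the same ENDs are re-plumbed in `MultiscaleDecayRowSumsAdd`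
(`wrs_inv_levelOp_le_add`, `wrs_dirInv_levelOp_le_add`, constant `× L^A`).  §1–§2 are geometry-free and unaffected.
-/

namespace Summit.QuantumFields.BalabanUV.Beta.MultiscaleDecayRowSums

open Finset Function
open Summit.QuantumFields.BalabanUV.Beta.BoxPoincare (Box)
open Summit.QuantumFields.BalabanUV.Beta.CovariantBoxPoincare (hol succ)
open Summit.QuantumFields.BalabanUV.Beta.MultiscaleCoerciveTorus
open Summit.QuantumFields.BalabanUV.Beta.MultiscaleDistance
open Summit.QuantumFields.BalabanUV.Beta.MultiscaleDistanceGraded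
open Summit.QuantumFields.BalabanUV.Beta.MultiscaleDecayBudget
open Summit.QuantumFields.BalabanUV.Beta.MultiscaleDecay
open Summit.QuantumFields.BalabanUV.Beta.MultiscaleDecayDirichlet
open Literature.MathematicalPhysics.QuantumFieldTheory.Balaban1983to89
open Literature.MathematicalPhysics.QuantumFieldTheory.Balaban1983to89.B9Thm37Sum (mulOp)
open Literature.MathematicalPhysics.QuantumFieldTheory.Balaban1983to89.B9Thm37GluePU (bsrc btgt)
open Literature.MathematicalPhysics.QuantumFieldTheory.Balaban1983to89.B9Thm37GlueTorusCov (tblk torusComb)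
open Literature.MathematicalPhysics.QuantumFieldTheory.Balaban1983to89.B9Thm37GlueTorusCovLevels (levelOp)
open Literature.MathematicalPhysics.QuantumFieldTheory.Balaban1983to89.B9Thm37GlueTorusInv (dirInv)
open B5TorusCover (UT Ctr ctrU)

noncomputable section

/-! ## §1 The shell decomposition: exponential sums under a growth bound -/

section Shell

variable {Y : Type} [Fintype Y]

/-- **Exponential sums under a growth bound.**  If `f ≥ 0` on a finite type has at most `N₀·Λ^m` points below each natural level `m`
(`#{y : f(y) < m} ≤ N₀Λ^m`), then for `δ ≥ 0` with `Λe^{−δ} < 1`: `Σ_y e^{−δ f(y)} ≤ N₀Λ/(1 − Λe^{−δ})` (decompose by `⌊f⌋ = r`: each shell has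
`≤ N₀Λ^{r+1}` points, each weighing `≤ e^{−δr}`; geometric series). [folklore] -/
theorem sum_exp_neg_le_of_growth (f : Y → ℝ) (hf : ∀ y, 0 ≤ f y) {N₀ Λ : ℝ} (hN₀ : 0 ≤ N₀) (hΛ : 0 ≤ Λ)
    (hcount : ∀ m : ℕ, ((univ.filter fun y => f y < m).card : ℝ) ≤ N₀ * Λ ^ m) {δ : ℝ} (hδ : 0 ≤ δ)
    (hq : Λ * Real.exp (-δ) < 1) :
    ∑ y, Real.exp (-(δ * f y)) ≤ N₀ * Λ / (1 - Λ * Real.exp (-δ)) := by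
  classical
  set q := Λ * Real.exp (-δ) with hqdef
  have hq0 : 0 ≤ q := mul_nonneg hΛ (Real.exp_pos _).le
  set g : Y → ℕ := fun y => ⌊f y⌋₊ with hg
  -- the shell `⌊f⌋ = r`: weight ≤ e^{−δr}, cardinality ≤ N₀Λ^{r+1}
  have hshell : ∀ r : ℕ, ∑ y ∈ univ.filter (fun y => g y = r), Real.exp (-(δ * f y)) ≤ N₀ * Λ * q ^ r := by
    intro r
    have hw : ∀ y ∈ univ.filter (fun y => g y = r), Real.exp (-(δ * f y)) ≤ Real.exp (-(δ * r)) := by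
      intro y hy
      have hr : (r : ℝ) ≤ f y := by
        have hgy : ⌊f y⌋₊ = r := (mem_filter.mp hy).2
        have := Nat.floor_le (hf y)
        rw [hgy] at this
        exact this
      exact Real.exp_le_exp.mpr (by nlinarith)
    have hcard : ((univ.filter fun y => g y = r).card : ℝ) ≤ N₀ * Λ ^ (r + 1) := by
      refine le_trans ?_ (hcount (r + 1))
      exact_mod_cast Finset.card_le_card (fun y hy => by
        rw [mem_filter] at hy ⊢
        refine ⟨hy.1, ?_⟩
        have := Nat.lt_floor_add_one (f y)
        rw [hg] at hy
        simp only at hy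
        rw [hy.2] at this
        exact_mod_cast this)
    calc ∑ y ∈ univ.filter (fun y => g y = r), Real.exp (-(δ * f y))
        ≤ ∑ y ∈ univ.filter (fun y => g y = r), Real.exp (-(δ * r)) := Finset.sum_le_sum hw
      _ = ((univ.filter fun y => g y = r).card : ℝ) * Real.exp (-(δ * r)) := by rw [Finset.sum_const, nsmul_eq_mul]
      _ ≤ N₀ * Λ ^ (r + 1) * Real.exp (-(δ * r)) := mul_le_mul_of_nonneg_right hcard (Real.exp_pos _).le
      _ = N₀ * Λ * q ^ r := by
          rw [hqdef, mul_pow, ← Real.exp_nat_mul, pow_succ]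
          ring_nf
  -- sum over the shells
  have hfib : ∑ y, Real.exp (-(δ * f y)) = ∑ r ∈ univ.image g, ∑ y ∈ univ.filter (fun y => g y = r), Real.exp (-(δ * f y)) := by
    rw [Finset.sum_fiberwise_of_maps_to (fun y hy => Finset.mem_image_of_mem g hy)]
  rw [hfib]
  have hsumm : Summable fun r : ℕ => N₀ * Λ * q ^ r := (summable_geometric_of_lt_one hq0 hq).mul_left _
  calc ∑ r ∈ univ.image g, ∑ y ∈ univ.filter (fun y => g y = r), Real.exp (-(δ * f y))
      ≤ ∑ r ∈ univ.image g, N₀ * Λ * q ^ r := Finset.sum_le_sum fun r _ => hshell r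
    _ ≤ ∑' r, N₀ * Λ * q ^ r := hsumm.sum_le_tsum _ fun r _ => mul_nonneg (mul_nonneg hN₀ hΛ) (pow_nonneg hq0 r)
    _ = N₀ * Λ * (1 - q)⁻¹ := by rw [tsum_mul_left, tsum_geometric_of_lt_one hq0 hq]
    _ = N₀ * Λ / (1 - Λ * Real.exp (-δ)) := by rw [hqdef, div_eq_mul_inv]

end Shell

/-! ## §2 Weighted row sums from entry decay with symmetric local prefactors -/

section WRS

variable {X Cp : Type} [Fintype X] [Fintype Cp]

/-- **WEIGHTED ROW SUMS FROM ENTRY DECAY (MODEL).**  A kernel `G` on `X × Cp` with `|G(p,q)| ≤ B·e^{−κD(p₁,q₁)}·n(p₁)n(q₁)`, scales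
comparing along `D` as `n(x′) ≤ n(x)·e^{c·D(x,x′)}` (GRADED), and at most `G₀·n(x)^{d₀}·Λ^m` sites `x′` with `D(x,x′) < m` (GROWTH): for every
rate `κ′` with `δ := κ − κ′ − c ≥ 0` and `Λe^{−δ} < 1`,
`Σ_q |G(p,q)|·e^{κ′D(p₁,q₁)} ≤ B·|Cp|·G₀·Λ/(1 − Λe^{−δ})·n(p₁)^{d₀+2}` — constants free of everything but `B, |Cp|, G₀, Λ, δ`; the prefactor is
the LOCAL scale to the power `d₀ + 2`. [cite: Balaban1988RG2Cluster, (2.16) p.15; Balaban1985BackgroundPropagators, (3.41)-(3.42) p.397] -/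
theorem wrs_le_of_entry_decay (D : X → X → ℝ) (hD : ∀ x x', 0 ≤ D x x') (n : X → ℕ) {c : ℝ}
    (hgr : ∀ x x', (n x' : ℝ) ≤ n x * Real.exp (c * D x x')) {G₀ Λ : ℝ} (hG₀ : 0 ≤ G₀) (hΛ : 0 ≤ Λ) {d₀ : ℕ}
    (hgrowth : ∀ x (m : ℕ), ((univ.filter fun x' => D x x' < m).card : ℝ) ≤ G₀ * (n x : ℝ) ^ d₀ * Λ ^ m)
    (G : X × Cp → X × Cp → ℝ) {B κ : ℝ} (hB : 0 ≤ B)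
    (hG : ∀ p q, |G p q| ≤ B * Real.exp (-(κ * D p.1 q.1)) * ((n p.1 : ℝ) * n q.1)) {κ' : ℝ} (hδ : 0 ≤ κ - κ' - c)
    (hq : Λ * Real.exp (-(κ - κ' - c)) < 1) (p : X × Cp) :
    ∑ q, |G p q| * Real.exp (κ' * D p.1 q.1) ≤
      B * (Fintype.card Cp) * (G₀ * Λ / (1 - Λ * Real.exp (-(κ - κ' - c)))) * (n p.1 : ℝ) ^ (d₀ + 2) := by
  set δ := κ - κ' - c with hδdef
  have hn0 : (0 : ℝ) ≤ n p.1 := Nat.cast_nonneg _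
  -- termwise: |G(p,q)| e^{κ′D} ≤ B n(p₁)² e^{−δ D(p₁,q₁)}
  have hterm : ∀ q : X × Cp, |G p q| * Real.exp (κ' * D p.1 q.1) ≤ B * (n p.1 : ℝ) ^ 2 * Real.exp (-(δ * D p.1 q.1)) := by
    intro q
    have h1 := hG p q
    have h2 := hgr p.1 q.1
    have he0 : 0 ≤ Real.exp (κ' * D p.1 q.1) := (Real.exp_pos _).le
    calc |G p q| * Real.exp (κ' * D p.1 q.1)
        ≤ B * Real.exp (-(κ * D p.1 q.1)) * ((n p.1 : ℝ) * n q.1) * Real.exp (κ' * D p.1 q.1) :=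
          mul_le_mul_of_nonneg_right h1 he0
      _ ≤ B * Real.exp (-(κ * D p.1 q.1)) * ((n p.1 : ℝ) * (n p.1 * Real.exp (c * D p.1 q.1))) * Real.exp (κ' * D p.1 q.1) := by
          refine mul_le_mul_of_nonneg_right (mul_le_mul_of_nonneg_left (mul_le_mul_of_nonneg_left h2 hn0)
            (mul_nonneg hB (Real.exp_pos _).le)) he0
      _ = B * (n p.1 : ℝ) ^ 2 * (Real.exp (-(κ * D p.1 q.1)) * Real.exp (c * D p.1 q.1) * Real.exp (κ' * D p.1 q.1)) := by ring
      _ = B * (n p.1 : ℝ) ^ 2 * Real.exp (-(δ * D p.1 q.1)) := by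
          rw [← Real.exp_add, ← Real.exp_add, hδdef]
          congr 1
          congr 1
          ring
  -- sum: sites × components
  have hsum : ∑ q : X × Cp, B * (n p.1 : ℝ) ^ 2 * Real.exp (-(δ * D p.1 q.1)) =
      B * (n p.1 : ℝ) ^ 2 * (Fintype.card Cp) * ∑ x', Real.exp (-(δ * D p.1 x')) := by
    rw [Fintype.sum_prod_type]
    simp only [Finset.sum_const, Finset.card_univ, nsmul_eq_mul, Finset.mul_sum]
    refine Finset.sum_congr rfl fun x' _ => ?_
    ring
  have hshell := sum_exp_neg_le_of_growth (fun x' => D p.1 x') (fun x' => hD p.1 x') (mul_nonneg hG₀ (pow_nonneg hn0 d₀)) hΛ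
    (fun m => hgrowth p.1 m) hδ hq
  calc ∑ q, |G p q| * Real.exp (κ' * D p.1 q.1)
      ≤ ∑ q : X × Cp, B * (n p.1 : ℝ) ^ 2 * Real.exp (-(δ * D p.1 q.1)) := Finset.sum_le_sum fun q _ => hterm q
    _ = B * (n p.1 : ℝ) ^ 2 * (Fintype.card Cp) * ∑ x', Real.exp (-(δ * D p.1 x')) := hsum
    _ ≤ B * (n p.1 : ℝ) ^ 2 * (Fintype.card Cp) * (G₀ * (n p.1 : ℝ) ^ d₀ * Λ / (1 - Λ * Real.exp (-δ))) :=
        mul_le_mul_of_nonneg_left hshell (by positivity)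
    _ = B * (Fintype.card Cp) * (G₀ * Λ / (1 - Λ * Real.exp (-(κ - κ' - c)))) * (n p.1 : ℝ) ^ (d₀ + 2) := by
        rw [hδdef]; ring

end WRS

/-! ## §3 The torus ENDs: weighted row sums of `(levelOp)⁻¹` and of its Dirichlet compressions -/

section Torus

variable {d : ℕ} {N : Fin d → ℕ} [∀ i, NeZero (N i)] [NeZero d] {Cp J K : Type} [Fintype Cp] [DecidableEq Cp] [Fintype J] [Fintype K]
  (S : J → ℕ) (hS : ∀ l, 1 ≤ S l) (hdivS : ∀ l i, S l ∣ N i) (lvl : K → J) (zc : (k : K) → Ctr N (S (lvl k)))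

/-- **LEVEL-FREE WEIGHTED ROW SUMS OF THE INVERSE OF THE MULTI-REGION AVERAGED OPERATOR (MODEL; item (ii-c)).**  Under the hypotheses of
`MultiscaleDecay.decay_levelOp` (rate `κ`, `μ₀ > 0`), GRADED cells (`n = L^e`, `|e(b₊) − e(b₋)| ≤ slen(b)/R`) and cell-count GROWTH
(`#{x′ : d_n(x,x′) < m} ≤ G₀·n(x)^{d₀}·Λ^m`), for every `κ′` with `δ = κ − κ′ − log L/R ≥ 0` and `Λe^{−δ} < 1`:
**`Σ_q |(levelOp)⁻¹(δ_q)(p)|·e^{κ′·d_n(p₁,q₁)} ≤ |Cp|·G₀·Λ/(μ₀(1 − Λe^{−δ}))·n(p₁)^{d₀+2}`** — the `wrs κ′ d_n` currency of [II] (2.16) with a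
constant seeing `d, c, a, C, L, R, G₀, Λ, κ, κ′` ONLY and the LOCAL prefactor `n(p₁)^{d₀+2}` (cf. gen-5's k-dependent `CovariantTowerWRS.wrs_LTorus`).
[cite: Balaban1988RG2Cluster, (2.16) p.15; Balaban1985BackgroundPropagators, (3.41)-(3.42) p.397; Balaban1984PropagatorsII, (2.1)-(2.2) p.224] -/
theorem wrs_inv_levelOp_le (hdisj : ∀ k k' v v', cellPt S hS hdivS lvl zc k v = cellPt S hS hdivS lvl zc k' v' → k = k')
    (hcover : ∀ x : UT N, ∃ k, ∃ v : Box d (S (lvl k)), cellPt S hS hdivS lvl zc k v = x)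
    (Rm : UT N × Fin d → Cp → Cp → ℝ) (hRm : ∀ b i j, ∑ k, Rm b k i * Rm b k j = if i = j then (1 : ℝ) else 0)
    (T : J → UT N → Cp → Cp → ℝ) (hT : ∀ l x i i', ∑ k, T l x k i * T l x k i' = if i = i' then (1 : ℝ) else 0)
    (a : J → ℝ) (ha : ∀ j, 0 ≤ a j) (ω : J → UT N → ℝ)
    (hsupp : ∀ l x, ω l (ctrU N (S l) (tblk (hS l) (hdivS l) x)) ≠ 0 → ∃ k v, lvl k = l ∧ cellPt S hS hdivS lvl zc k v = x)
    {amax : ℝ} (hamax : 0 ≤ amax)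
    (hscale : ∀ k, a (lvl k) * ω (lvl k) (ctrU N (S (lvl k)) (zc k)) ^ 2 * (S (lvl k) : ℝ) ^ d ≤ amax / (S (lvl k) : ℝ) ^ 2)
    (c : UT N × Fin d → ℝ) {cmax : ℝ} (hc : ∀ b, |c b| ≤ cmax) {C : ℝ}
    (hcoer : ∀ f : UT N × Cp → ℝ,
      C * ∑ k, ((S (lvl k) : ℝ) ^ 2)⁻¹ * ∑ v : Box d (S (lvl k)), ∑ i, f (cellPt S hS hdivS lvl zc k v, i) ^ 2 ≤
        ∑ p, f p * levelOp bsrc btgt c Rm (fun l x => ctrU N (S l) (tblk (hS l) (hdivS l) x))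
          (fun l x => ω l (ctrU N (S l) (tblk (hS l) (hdivS l) x))) T a f p)
    {κ : ℝ} (hκ0 : 0 ≤ κ) (hκ1 : κ ≤ 1) (hμ : 0 < C - 2 * d * cmax ^ 2 * κ ^ 2 - amax * (Real.exp (2 * d * κ) - 1))
    -- the two geometry clauses (SHAPE of [B6] (2.1)-(2.2)) and the rate condition
    {L : ℕ} (hL : 1 ≤ L) (e : UT N → ℕ) (hne : ∀ x, siteScale S hS hdivS lvl zc hcover x = L ^ e x) {R : ℝ} (hR : 0 < R)
    (hgr : ∀ b, |(e (btgt b) : ℝ) - e (bsrc b)| ≤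
      slen (siteScale S hS hdivS lvl zc hcover) (bsrc b) (btgt b) / R)
    {G₀ Λ : ℝ} (hG₀ : 0 ≤ G₀) (hΛ : 0 ≤ Λ) {d₀ : ℕ}
    (hgrowth : ∀ x (m : ℕ), ((univ.filter fun x' => sdist bsrc btgt (siteScale S hS hdivS lvl zc hcover) x x' < m).card : ℝ) ≤
      G₀ * (siteScale S hS hdivS lvl zc hcover x : ℝ) ^ d₀ * Λ ^ m)
    {κ' : ℝ} (hδ : 0 ≤ κ - κ' - Real.log L / R) (hq : Λ * Real.exp (-(κ - κ' - Real.log L / R)) < 1) (p : UT N × Cp) :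
    ∑ q, |Ring.inverse (levelOp bsrc btgt c Rm (fun l x => ctrU N (S l) (tblk (hS l) (hdivS l) x))
          (fun l x => ω l (ctrU N (S l) (tblk (hS l) (hdivS l) x))) T a) (Pi.single q 1) p| *
        Real.exp (κ' * sdist bsrc btgt (siteScale S hS hdivS lvl zc hcover) p.1 q.1) ≤
      (C - 2 * d * cmax ^ 2 * κ ^ 2 - amax * (Real.exp (2 * d * κ) - 1))⁻¹ * (Fintype.card Cp) *
        (G₀ * Λ / (1 - Λ * Real.exp (-(κ - κ' - Real.log L / R)))) * (siteScale S hS hdivS lvl zc hcover p.1 : ℝ) ^ (d₀ + 2) := by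
  set n := siteScale S hS hdivS lvl zc hcover with hn
  set μ₀ := C - 2 * d * cmax ^ 2 * κ ^ 2 - amax * (Real.exp (2 * d * κ) - 1) with hμ₀
  set A := levelOp bsrc btgt c Rm (fun l x => ctrU N (S l) (tblk (hS l) (hdivS l) x))
    (fun l x => ω l (ctrU N (S l) (tblk (hS l) (hdivS l) x))) T a with hA
  have hGb : ∀ p' q' : UT N × Cp, |Ring.inverse A (Pi.single q' 1) p'| ≤
      μ₀⁻¹ * Real.exp (-(κ * sdist bsrc btgt n p'.1 q'.1)) * ((n p'.1 : ℝ) * n q'.1) := by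
    intro p' q'
    have h := (decay_levelOp S hS hdivS lvl zc hdisj hcover Rm hRm T hT a ha ω hsupp hamax hscale c hc hcoer hκ0 hκ1 hμ p' q').2
    calc |Ring.inverse A (Pi.single q' 1) p'|
        ≤ Real.exp (-(κ * sdist bsrc btgt n p'.1 q'.1)) * ((n p'.1 : ℝ) * (n q'.1 : ℝ)) / μ₀ := h
      _ = μ₀⁻¹ * Real.exp (-(κ * sdist bsrc btgt n p'.1 q'.1)) * ((n p'.1 : ℝ) * n q'.1) := by rw [div_eq_mul_inv]; ring
  exact wrs_le_of_entry_decay (fun x x' => sdist bsrc btgt n x x') (fun x x' => sdist_nonneg bsrc btgt n x x') n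
    (c := Real.log L / R) (fun x x' => scale_le_scale_mul_exp bsrc btgt n hL e hne hR hgr (reachable_torus x x')) hG₀ hΛ hgrowth
    (fun p' q' => Ring.inverse A (Pi.single q' 1) p') (B := μ₀⁻¹) (κ := κ) (inv_nonneg.mpr hμ.le) hGb hδ hq p

/-- **The same for EVERY Dirichlet compression** `dirInv (levelOp) χ` (constant `min(μ₀,1)⁻¹`).
[cite: Balaban1988RG2Cluster, (2.16) p.15; Balaban1985BackgroundPropagators, (3.86)-(3.88) pp.408-409] -/
theorem wrs_dirInv_levelOp_le (hdisj : ∀ k k' v v', cellPt S hS hdivS lvl zc k v = cellPt S hS hdivS lvl zc k' v' → k = k')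
    (hcover : ∀ x : UT N, ∃ k, ∃ v : Box d (S (lvl k)), cellPt S hS hdivS lvl zc k v = x)
    (Rm : UT N × Fin d → Cp → Cp → ℝ) (hRm : ∀ b i j, ∑ k, Rm b k i * Rm b k j = if i = j then (1 : ℝ) else 0)
    (T : J → UT N → Cp → Cp → ℝ) (hT : ∀ l x i i', ∑ k, T l x k i * T l x k i' = if i = i' then (1 : ℝ) else 0)
    (a : J → ℝ) (ha : ∀ j, 0 ≤ a j) (ω : J → UT N → ℝ)
    (hsupp : ∀ l x, ω l (ctrU N (S l) (tblk (hS l) (hdivS l) x)) ≠ 0 → ∃ k v, lvl k = l ∧ cellPt S hS hdivS lvl zc k v = x)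
    {amax : ℝ} (hamax : 0 ≤ amax)
    (hscale : ∀ k, a (lvl k) * ω (lvl k) (ctrU N (S (lvl k)) (zc k)) ^ 2 * (S (lvl k) : ℝ) ^ d ≤ amax / (S (lvl k) : ℝ) ^ 2)
    (c : UT N × Fin d → ℝ) {cmax : ℝ} (hc : ∀ b, |c b| ≤ cmax) {C : ℝ}
    (hcoer : ∀ f : UT N × Cp → ℝ,
      C * ∑ k, ((S (lvl k) : ℝ) ^ 2)⁻¹ * ∑ v : Box d (S (lvl k)), ∑ i, f (cellPt S hS hdivS lvl zc k v, i) ^ 2 ≤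
        ∑ p, f p * levelOp bsrc btgt c Rm (fun l x => ctrU N (S l) (tblk (hS l) (hdivS l) x))
          (fun l x => ω l (ctrU N (S l) (tblk (hS l) (hdivS l) x))) T a f p)
    {κ : ℝ} (hκ0 : 0 ≤ κ) (hκ1 : κ ≤ 1) (hμ : 0 < C - 2 * d * cmax ^ 2 * κ ^ 2 - amax * (Real.exp (2 * d * κ) - 1))
    (χ : UT N × Cp → ℝ) (hχ : ∀ p, χ p = 0 ∨ χ p = 1)
    {L : ℕ} (hL : 1 ≤ L) (e : UT N → ℕ) (hne : ∀ x, siteScale S hS hdivS lvl zc hcover x = L ^ e x) {R : ℝ} (hR : 0 < R)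
    (hgr : ∀ b, |(e (btgt b) : ℝ) - e (bsrc b)| ≤
      slen (siteScale S hS hdivS lvl zc hcover) (bsrc b) (btgt b) / R)
    {G₀ Λ : ℝ} (hG₀ : 0 ≤ G₀) (hΛ : 0 ≤ Λ) {d₀ : ℕ}
    (hgrowth : ∀ x (m : ℕ), ((univ.filter fun x' => sdist bsrc btgt (siteScale S hS hdivS lvl zc hcover) x x' < m).card : ℝ) ≤
      G₀ * (siteScale S hS hdivS lvl zc hcover x : ℝ) ^ d₀ * Λ ^ m)
    {κ' : ℝ} (hδ : 0 ≤ κ - κ' - Real.log L / R) (hq : Λ * Real.exp (-(κ - κ' - Real.log L / R)) < 1) (p : UT N × Cp) :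
    ∑ q, |dirInv (levelOp bsrc btgt c Rm (fun l x => ctrU N (S l) (tblk (hS l) (hdivS l) x))
          (fun l x => ω l (ctrU N (S l) (tblk (hS l) (hdivS l) x))) T a) χ (Pi.single q 1) p| *
        Real.exp (κ' * sdist bsrc btgt (siteScale S hS hdivS lvl zc hcover) p.1 q.1) ≤
      (min (C - 2 * d * cmax ^ 2 * κ ^ 2 - amax * (Real.exp (2 * d * κ) - 1)) 1)⁻¹ * (Fintype.card Cp) *
        (G₀ * Λ / (1 - Λ * Real.exp (-(κ - κ' - Real.log L / R)))) * (siteScale S hS hdivS lvl zc hcover p.1 : ℝ) ^ (d₀ + 2) := by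
  set n := siteScale S hS hdivS lvl zc hcover with hn
  set μ₁ := min (C - 2 * d * cmax ^ 2 * κ ^ 2 - amax * (Real.exp (2 * d * κ) - 1)) 1 with hμ₁
  have hμ₁pos : 0 < μ₁ := lt_min hμ zero_lt_one
  set A := levelOp bsrc btgt c Rm (fun l x => ctrU N (S l) (tblk (hS l) (hdivS l) x))
    (fun l x => ω l (ctrU N (S l) (tblk (hS l) (hdivS l) x))) T a with hA
  have hGb : ∀ p' q' : UT N × Cp, |dirInv A χ (Pi.single q' 1) p'| ≤
      μ₁⁻¹ * Real.exp (-(κ * sdist bsrc btgt n p'.1 q'.1)) * ((n p'.1 : ℝ) * n q'.1) := by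
    intro p' q'
    have h := (decay_dirInv_levelOp S hS hdivS lvl zc hdisj hcover Rm hRm T hT a ha ω hsupp hamax hscale c hc hcoer hκ0 hκ1 hμ χ hχ
      p' q').2
    calc |dirInv A χ (Pi.single q' 1) p'|
        ≤ Real.exp (-(κ * sdist bsrc btgt n p'.1 q'.1)) * ((n p'.1 : ℝ) * (n q'.1 : ℝ)) / μ₁ := h
      _ = μ₁⁻¹ * Real.exp (-(κ * sdist bsrc btgt n p'.1 q'.1)) * ((n p'.1 : ℝ) * n q'.1) := by rw [div_eq_mul_inv]; ring
  exact wrs_le_of_entry_decay (fun x x' => sdist bsrc btgt n x x') (fun x x' => sdist_nonneg bsrc btgt n x x') n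
    (c := Real.log L / R) (fun x x' => scale_le_scale_mul_exp bsrc btgt n hL e hne hR hgr (reachable_torus x x')) hG₀ hΛ hgrowth
    (fun p' q' => dirInv A χ (Pi.single q' 1) p') (B := μ₁⁻¹) (κ := κ) (inv_nonneg.mpr hμ₁pos.le) hGb hδ hq p

end Torus

end

end Summit.QuantumFields.BalabanUV.Beta.MultiscaleDecayRowSums
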